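import Summits.QuantumFields.BalabanUV.T4Continuum.Support.G183FreePartOneDim

/-!
# G183FreePartSubordination — part 2/5 of the proof of `G183KernelRates.FreePartRate`: the resolvent weight `w_N` and the
# subordination identity `Σ_{j<N}(F+1)^{−(j+1)} = ∫₀^∞ w_N(t)e^{−tF}dt` (§3); the heat-kernel representation
# `freeKer l N y = ∫₀^∞ w_N(t)·Π_ν l·q_{2l²t}(y_ν) dt` (§4, Fubini over the Brillouin zone + the tree's
# `setIntegral_prod_srwHeatIntegrand`)

Cell `pub-balaban`, T4-DAG §5 node U1a, spine estimate NE2, prover P2, lineage t4-ne2-p2 gen 8, row T4-U1a.E-NE2-PROVE-P2h*.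
HONEST FRAMING: rung (B)+1 bookkeeping for the LINEAR theory at `U = 1` on the infinite fine lattices `(1/n)ℤ^{d+1}`; NOT the
torus, NOT `U ≠ 1`, NOT infinite-volume physics, NOT a mass gap, NOT Clay.  Inputs: Mathlib and kernel-proved tree theorems BY
NAME (`Literature.Probability.LatticeModels.*` after Lawler–Limic 2010 [LawlerLimic2010]; `G183KernelRates` gen 7); nothing
printed in the audited papers is a hypothesis; no `def … : Prop` is assumed; no `sorry`.  All namespace
`Summit.QuantumFields.BalabanUV.T4Continuum.G183FreePartRate` (one proof split over five ≤ 400-line files: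
`G183FreePartOneDim` §1–§2 → `G183FreePartSubordination` §3–§4 → `G183FreePartProducts` §5–§6 → `G183FreePartPieces` §7 →
`G183FreePartRate` §8 = the theorem and the full header: statement, proof outline, reading, sources).
-/

noncomputable section

open MeasureTheory Set Filter Real
open scoped Real Topology BigOperators

namespace Summit.QuantumFields.BalabanUV.T4Continuum.G183FreePartRate

open Literature.Probability.LatticeModels

/-! ## §3 The resolvent weight and the subordination identity -/

/-- the resolvent weight `w_N(t) = e^{−t} Σ_{j<N} t^j/j!` (`Σ_{j<N}(F+1)^{−(j+1)} = ∫₀^∞ w_N(t) e^{−tF} dt`). [folklore] -/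
def wN (N : ℕ) (t : ℝ) : ℝ := Real.exp (-t) * ∑ j ∈ Finset.range N, t ^ j / (j.factorial : ℝ)

/-- `w_N(t) ≥ 0` for `t ≥ 0`. [folklore] -/
theorem wN_nonneg (N : ℕ) {t : ℝ} (ht : 0 ≤ t) : 0 ≤ wN N t :=
  mul_nonneg (Real.exp_pos _).le (Finset.sum_nonneg fun j _ => by positivity)

/-- `w_N` is continuous. [folklore] -/
theorem continuous_wN (N : ℕ) : Continuous (wN N) := by
  unfold wN; fun_prop

/-- `w_N(t) ≤ 2^N e^{−t/2}` for `t ≥ 0`. [folklore] -/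
theorem wN_le (N : ℕ) {t : ℝ} (ht : 0 ≤ t) : wN N t ≤ 2 ^ N * Real.exp (-(1 / 2) * t) := by
  have hterm : ∀ j ∈ Finset.range N, t ^ j / (j.factorial : ℝ) ≤ 2 ^ j * Real.exp (t / 2) := by
    intro j _
    have h := Real.pow_div_factorial_le_exp (hx := (by positivity : 0 ≤ t / 2)) (n := j)
    have e : t ^ j / (j.factorial : ℝ) = 2 ^ j * ((t / 2) ^ j / (j.factorial : ℝ)) := by
      rw [mul_div_assoc', ← mul_pow]; congr 2; ring
    rw [e]
    exact mul_le_mul_of_nonneg_left h (by positivity)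
  have hgeom : ∑ j ∈ Finset.range N, (2 : ℝ) ^ j ≤ 2 ^ N := by
    rw [geom_sum_eq (by norm_num : (2 : ℝ) ≠ 1)]
    norm_num
  have hsum : ∑ j ∈ Finset.range N, t ^ j / (j.factorial : ℝ) ≤ 2 ^ N * Real.exp (t / 2) := by
    calc ∑ j ∈ Finset.range N, t ^ j / (j.factorial : ℝ) ≤ ∑ j ∈ Finset.range N, 2 ^ j * Real.exp (t / 2) :=
          Finset.sum_le_sum hterm
      _ = (∑ j ∈ Finset.range N, (2 : ℝ) ^ j) * Real.exp (t / 2) := by rw [Finset.sum_mul]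
      _ ≤ 2 ^ N * Real.exp (t / 2) := mul_le_mul_of_nonneg_right hgeom (Real.exp_pos _).le
  unfold wN
  calc Real.exp (-t) * ∑ j ∈ Finset.range N, t ^ j / (j.factorial : ℝ)
      ≤ Real.exp (-t) * (2 ^ N * Real.exp (t / 2)) := mul_le_mul_of_nonneg_left hsum (Real.exp_pos _).le
    _ = 2 ^ N * (Real.exp (-t) * Real.exp (t / 2)) := by ring
    _ = 2 ^ N * Real.exp (-(1 / 2) * t) := by rw [← Real.exp_add]; congr 2; ring

/-- the Gamma integrals: `∫₀^∞ t^j e^{−(F+1)t} dt = j!/(F+1)^{j+1}`. [folklore] -/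
theorem integral_pow_mul_exp (j : ℕ) {r : ℝ} (hr : 0 < r) :
    IntegrableOn (fun t : ℝ => t ^ j * Real.exp (-(r * t))) (Ioi 0) ∧
      ∫ t in Ioi (0 : ℝ), t ^ j * Real.exp (-(r * t)) = (j.factorial : ℝ) / r ^ (j + 1) := by
  constructor
  · have h := integrableOn_rpow_mul_exp_neg_mul_rpow (s := (j : ℝ)) (p := 1)
      (by have : (0:ℝ) ≤ j := Nat.cast_nonneg j; linarith) le_rfl hr
    refine h.congr_fun (fun t _ => ?_) measurableSet_Ioi
    simp only [Real.rpow_natCast, Real.rpow_one, neg_mul]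
  · have h := Real.integral_rpow_mul_exp_neg_mul_Ioi (a := (j : ℝ) + 1) (r := r) (by positivity) hr
    simp only [add_sub_cancel_right, Real.rpow_natCast] at h
    rw [h, Real.Gamma_nat_eq_factorial, show ((j : ℝ) + 1) = ((j + 1 : ℕ) : ℝ) by push_cast; ring,
      Real.rpow_natCast, one_div_pow]
    ring

/-- **subordination**: `Σ_{j<N} 1/(F+1)^{j+1} = ∫₀^∞ w_N(t) e^{−tF} dt` for `F ≥ 0`, the integrand integrable. [folklore] -/
theorem resolvSum_eq_integral (N : ℕ) {F : ℝ} (hF : 0 ≤ F) :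
    IntegrableOn (fun t : ℝ => wN N t * Real.exp (-(t * F))) (Ioi 0) ∧
      (∑ j ∈ Finset.range N, 1 / (F + 1) ^ (j + 1)) = ∫ t in Ioi (0 : ℝ), wN N t * Real.exp (-(t * F)) := by
  have hr : 0 < F + 1 := by linarith
  have hpt : ∀ t : ℝ, wN N t * Real.exp (-(t * F)) =
      ∑ j ∈ Finset.range N, (1 / (j.factorial : ℝ)) * (t ^ j * Real.exp (-((F + 1) * t))) := by
    intro t
    unfold wN
    rw [mul_comm (Real.exp (-t)), mul_assoc, ← Real.exp_add, Finset.sum_mul]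
    refine Finset.sum_congr rfl fun j _ => ?_
    rw [show -t + -(t * F) = -((F + 1) * t) by ring]
    ring
  have hint : ∀ j ∈ Finset.range N,
      IntegrableOn (fun t : ℝ => (1 / (j.factorial : ℝ)) * (t ^ j * Real.exp (-((F + 1) * t)))) (Ioi 0) :=
    fun j _ => ((integral_pow_mul_exp j hr).1).const_mul _
  constructor
  · have h : IntegrableOn (fun t : ℝ => ∑ j ∈ Finset.range N,
        (1 / (j.factorial : ℝ)) * (t ^ j * Real.exp (-((F + 1) * t)))) (Ioi 0) :=
      integrable_finsetSum (s := Finset.range N) hint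
    exact h.congr_fun (fun t _ => (hpt t).symm) measurableSet_Ioi
  · simp_rw [hpt]
    rw [integral_finsetSum _ hint]
    refine Finset.sum_congr rfl fun j _ => ?_
    rw [integral_const_mul, (integral_pow_mul_exp j hr).2]
    have hf : (j.factorial : ℝ) ≠ 0 := by exact_mod_cast (Nat.factorial_pos j).ne'
    field_simp


/-! ## §4 The heat-kernel representation of `freeKer` -/

section Representation

variable {d : ℕ}

open Literature.MathematicalPhysics.QuantumFieldTheory.Balaban1983to89
open B4Strip (ofRealVec)
open B4ContourShift (latticeKernel supNorm BZ integrand phase fourierBox)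
open B5G183CovSplit (resolv)
open B5G183FreeDecay (freeMult fineSym)
open G183KernelRates (freeKer fineSym_ofRealVec fineSymReal_bounds resolv_ofReal)

/-- the lineage's Brillouin zone `BZ D = [-π,π]^D` IS the lattice-models one. [folklore] -/
theorem BZ_eq_brillouin (D : ℕ) : BZ D = brillouin D := by
  unfold BZ brillouin
  rw [Set.pi_univ_Icc]

/-- the level-`l` PRODUCT heat kernel at physical time `t`: `P_l(t, y) = Π_ν (l · q_{2l²t}(y_ν))` (`y` a level-`l` fine point).
[folklore] -/
def levelProd (l : ℕ) (t : ℝ) (y : Fin (d + 1) → ℤ) : ℝ :=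
  ∏ ν, (l : ℝ) * srwHeatKernel (2 * (l : ℝ) ^ 2 * t) (y ν)

/-- `‖F_{s,m}(z)‖ = e^{−s(1 − cos z)}` at real momentum `z`. [folklore] -/
theorem norm_srwHeatIntegrand_ofReal (s : ℝ) (m : ℤ) (z : ℝ) :
    ‖srwHeatIntegrand s m z‖ = Real.exp (-(s * (1 - Real.cos z))) := by
  unfold srwHeatIntegrand
  have e1 : Complex.exp (Complex.I * (z : ℂ) * (m : ℂ)) = Complex.exp (((z * m : ℝ)) * Complex.I) := by
    congr 1; push_cast; ring
  have e2 : -(s : ℂ) * (1 - Complex.cos (z : ℂ)) = ((-(s * (1 - Real.cos z)) : ℝ) : ℂ) := by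
    push_cast; ring
  rw [norm_mul, e1, Complex.norm_exp_ofReal_mul_I, one_mul, e2, ← Complex.ofReal_exp, Complex.norm_real,
    Real.norm_eq_abs, abs_of_pos (Real.exp_pos _)]

/-- the product of the 1D heat integrands is the `D`-dimensional one:
`Π_ν F_{s,x_ν}(p_ν) = e^{−s Σ_ν(1 − cos p_ν)} e^{i p·x}`. [folklore] -/
theorem prod_srwHeatIntegrand_eq (s : ℝ) (x : Fin (d + 1) → ℤ) (p : Fin (d + 1) → ℝ) :
    ∏ ν, srwHeatIntegrand s (x ν) (p ν) =
      ((Real.exp (-(s * ∑ ν, (1 - Real.cos (p ν)))) : ℝ) : ℂ) * Complex.exp (Complex.I * phase p x) := by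
  have hprod : ∏ ν, srwHeatIntegrand s (x ν) (p ν) =
      Complex.exp (∑ ν, (-(s : ℂ) * (1 - Complex.cos (p ν)) + Complex.I * (p ν : ℂ) * (x ν : ℂ))) := by
    rw [Complex.exp_sum]
    refine Finset.prod_congr rfl fun ν _ => ?_
    unfold srwHeatIntegrand
    rw [← Complex.exp_add]; congr 1; ring
  rw [hprod, Finset.sum_add_distrib, Complex.exp_add]
  congr 1
  · rw [Complex.ofReal_exp]; congr 1
    push_cast
    rw [Finset.mul_sum, ← Finset.sum_neg_distrib]
    refine Finset.sum_congr rfl fun ν _ => by ring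
  · congr 1
    unfold phase
    rw [Finset.mul_sum]
    refine Finset.sum_congr rfl fun ν _ => by ring

/-- joint continuity of `(t,p) ↦ Π_ν e^{ip_ν x_ν}e^{−2n²t(1−cos p_ν)}` (for Fubini). [folklore] -/
theorem continuous_prodIntegrand (n : ℕ) (x : Fin (d + 1) → ℤ) :
    Continuous fun q : (Fin (d + 1) → ℝ) × ℝ => ∏ ν, srwHeatIntegrand (2 * (n : ℝ) ^ 2 * q.2) (x ν) (q.1 ν) := by
  refine continuous_finsetProd _ fun ν _ => ?_
  unfold srwHeatIntegrand
  fun_prop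

/-- **THE HEAT-KERNEL REPRESENTATION OF THE FREE PART** (`U = 1`): for every level `n ≥ 1`, `N`, and fine point `x`,
`freeKer n N x = ∫₀^∞ w_N(t) · Π_ν (n q_{2n²t}(x_ν)) dt`, the integrand integrable on `(0,∞)` — subordination
`Σ_{j<N}(F+1)^{−(j+1)} = ∫₀^∞ w_N(t)e^{−tF}dt` at `F = Σ_μ n²(2 − 2cos p_μ)`, Fubini on `[-π,π]^{d+1} × (0,∞)` (the mass makes
the double integral absolutely convergent: `|integrand| ≤ w_N(t) ≤ 2^N e^{−t/2}`), and the coordinate-wise product structure of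
`e^{−2n²t Σ(1−cos p_ν)} e^{ip·x}` (`setIntegral_prod_srwHeatIntegrand`). [folklore] -/
theorem freeKer_eq_integral (n : ℕ) [NeZero n] (N : ℕ) (x : Fin (d + 1) → ℤ) :
    IntegrableOn (fun t : ℝ => wN N t * levelProd (d := d) n t x) (Ioi 0) ∧
      freeKer (d := d) n N x = ((∫ t in Ioi (0 : ℝ), wN N t * levelProd (d := d) n t x : ℝ) : ℂ) := by
  have hn : (1 : ℝ) ≤ n := by exact_mod_cast Nat.one_le_iff_ne_zero.mpr (NeZero.ne n)
  have hn0 : (0 : ℝ) < n := by linarith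
  have hπ : (0 : ℝ) < (2 * π) ^ (d + 1) := by positivity
  set μ : Measure (Fin (d + 1) → ℝ) := volume.restrict (BZ (d + 1)) with hμ
  set ν : Measure ℝ := volume.restrict (Ioi (0 : ℝ)) with hν
  -- the real symbol `F(p) = Σ n²(2 − 2cos p_μ) = 2n² Σ (1 − cos p_μ) ≥ 0`
  set F : (Fin (d + 1) → ℝ) → ℝ := fun p => ∑ μ, (n : ℝ) ^ 2 * (2 - 2 * Real.cos (p μ)) with hF
  have hF0 : ∀ p, 0 ≤ F p := fun p => (fineSymReal_bounds (d := d) n p).1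
  have hF2 : ∀ p t, t * F p = 2 * (n : ℝ) ^ 2 * t * ∑ ν, (1 - Real.cos (p ν)) := by
    intro p t
    simp only [hF]
    rw [Finset.mul_sum, Finset.mul_sum]
    exact Finset.sum_congr rfl fun ν _ => by ring
  -- the joint integrand
  set G : (Fin (d + 1) → ℝ) × ℝ → ℂ := fun q =>
    ((wN N q.2 : ℝ) : ℂ) * ∏ ν, srwHeatIntegrand (2 * (n : ℝ) ^ 2 * q.2) (x ν) (q.1 ν) with hG
  have hG_cont : Continuous G :=
    (Complex.continuous_ofReal.comp ((continuous_wN N).comp continuous_snd)).mul (continuous_prodIntegrand n x)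
  have hG_meas : AEStronglyMeasurable G (μ.prod ν) := hG_cont.aestronglyMeasurable
  -- `‖G(p,t)‖ ≤ w_N(t) ≤ 2^N e^{-t/2}` for `t ≥ 0`
  have hG_norm : ∀ (p : Fin (d + 1) → ℝ) (t : ℝ), 0 ≤ t → ‖G (p, t)‖ ≤ 2 ^ N * Real.exp (-(1 / 2) * t) := by
    intro p t ht
    simp only [hG]
    rw [norm_mul, Complex.norm_real, Real.norm_eq_abs, abs_of_nonneg (wN_nonneg N ht), norm_prod]
    have hprod : ∏ ν, ‖srwHeatIntegrand (2 * (n : ℝ) ^ 2 * t) (x ν) ((p ν : ℝ) : ℂ)‖ ≤ 1 := by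
      refine Finset.prod_le_one (fun ν _ => norm_nonneg _) fun ν _ => ?_
      rw [norm_srwHeatIntegrand_ofReal, Real.exp_le_one_iff, neg_nonpos]
      exact mul_nonneg (by positivity) (by linarith [Real.cos_le_one (p ν)])
    calc wN N t * ∏ ν, ‖srwHeatIntegrand (2 * (n : ℝ) ^ 2 * t) (x ν) ((p ν : ℝ) : ℂ)‖
        ≤ wN N t * 1 := mul_le_mul_of_nonneg_left hprod (wN_nonneg N ht)
      _ ≤ 2 ^ N * Real.exp (-(1 / 2) * t) := by rw [mul_one]; exact wN_le N ht
  have hdom : IntegrableOn (fun t : ℝ => (2 : ℝ) ^ N * Real.exp (-(1 / 2) * t)) (Ioi 0) :=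
    (exp_neg_integrableOn_Ioi 0 (by norm_num : (0 : ℝ) < 1 / 2)).const_mul ((2 : ℝ) ^ N)
  have hGp : ∀ p, Integrable (fun t => G (p, t)) ν := by
    intro p
    refine Integrable.mono' hdom (hG_cont.comp (Continuous.prodMk_right p)).aestronglyMeasurable ?_
    rw [hν]
    filter_upwards [ae_restrict_mem measurableSet_Ioi] with t ht
    exact hG_norm p t (le_of_lt ht)
  haveI : IsFiniteMeasure μ := by
    rw [hμ]; unfold BZ
    exact isFiniteMeasure_restrict.2 (isCompact_Icc.measure_lt_top.ne)
  have hGint : Integrable G (μ.prod ν) := by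
    rw [integrable_prod_iff hG_meas]
    refine ⟨Eventually.of_forall hGp, ?_⟩
    refine Integrable.mono' (integrable_const (∫ t in Ioi (0 : ℝ), (2 : ℝ) ^ N * Real.exp (-(1 / 2) * t)))
      hG_meas.norm.integral_prod_right' (Eventually.of_forall fun p => ?_)
    rw [Real.norm_eq_abs, abs_of_nonneg (integral_nonneg fun t => norm_nonneg _)]
    exact setIntegral_mono_on (hGp p).norm hdom measurableSet_Ioi fun t ht => hG_norm p t (le_of_lt ht)
  -- the pointwise factorisation of `G`
  have hGpt : ∀ p t, G (p, t) =
      (((wN N t * Real.exp (-(t * F p))) : ℝ) : ℂ) * Complex.exp (Complex.I * phase p x) := by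
    intro p t
    simp only [hG]
    rw [prod_srwHeatIntegrand_eq, hF2 p t]
    push_cast
    ring
  -- the `t`-integral at fixed `p` is the Fourier integrand of the free part
  have hinner_t : ∀ p, ∫ t, G (p, t) ∂ν = integrand (fun q : Fin (d + 1) → ℂ => freeMult n N q) x p := by
    intro p
    simp only [hGpt]
    rw [integral_mul_const, integral_complex_ofReal, hν, ← (resolvSum_eq_integral N (hF0 p)).2]
    have hfs : freeMult n N (ofRealVec p) = ((∑ j ∈ Finset.range N, 1 / (F p + 1) ^ (j + 1) : ℝ) : ℂ) := by
      unfold freeMult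
      rw [fineSym_ofRealVec, resolv_ofReal]
    simp only [integrand]
    rw [hfs]
  -- the `p`-integral at fixed `t` is the product of 1D heat kernels
  have hinner_p : ∀ t, ∫ p, G (p, t) ∂μ =
      ((wN N t * ((2 * π) ^ (d + 1) * ∏ ν, srwHeatKernel (2 * (n : ℝ) ^ 2 * t) (x ν)) : ℝ) : ℂ) := by
    intro t
    simp only [hG, hμ]
    rw [integral_const_mul, BZ_eq_brillouin, setIntegral_prod_srwHeatIntegrand]
    push_cast
    congr 1
    rw [Finset.prod_mul_distrib, Finset.prod_const, Finset.card_univ, Fintype.card_fin]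
  -- Fubini
  have hbox : fourierBox (fun q : Fin (d + 1) → ℂ => freeMult n N q) x =
      ((((2 * π) ^ (d + 1) * ∫ t in Ioi (0 : ℝ), wN N t * ∏ ν, srwHeatKernel (2 * (n : ℝ) ^ 2 * t) (x ν)) : ℝ) : ℂ) := by
    unfold fourierBox
    rw [← hμ]
    calc ∫ p, integrand (fun q : Fin (d + 1) → ℂ => freeMult n N q) x p ∂μ
        = ∫ p, ∫ t, G (p, t) ∂ν ∂μ := integral_congr_ae (Eventually.of_forall fun p => (hinner_t p).symm)
      _ = ∫ t, ∫ p, G (p, t) ∂μ ∂ν := integral_integral_swap hGint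
      _ = ∫ t, ((wN N t * ((2 * π) ^ (d + 1) * ∏ ν, srwHeatKernel (2 * (n : ℝ) ^ 2 * t) (x ν)) : ℝ) : ℂ) ∂ν :=
          integral_congr_ae (Eventually.of_forall fun t => hinner_p t)
      _ = _ := by
          rw [integral_complex_ofReal, hν, ← integral_const_mul]
          congr 1
          refine integral_congr_ae (Eventually.of_forall fun t => ?_)
          simp only
          ring
  -- integrability of the real `t`-integrand
  have hIntR : IntegrableOn (fun t : ℝ => wN N t * levelProd (d := d) n t x) (Ioi 0) := by
    have h1 : Integrable (fun t => ∫ p, G (p, t) ∂μ) ν := hGint.integral_prod_right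
    have h2 : Integrable (fun t => wN N t * ((2 * π) ^ (d + 1) * ∏ ν, srwHeatKernel (2 * (n : ℝ) ^ 2 * t) (x ν))) ν := by
      have h := h1.re
      refine h.congr (Eventually.of_forall fun t => ?_)
      simp only [hinner_p, RCLike.re_to_complex, Complex.ofReal_re]
    have h3 := h2.const_mul (((2 * π) ^ (d + 1))⁻¹ * (n : ℝ) ^ (d + 1))
    rw [hν] at h3
    refine h3.congr (Eventually.of_forall fun t => ?_)
    simp only [levelProd]
    rw [Finset.prod_mul_distrib, Finset.prod_const, Finset.card_univ, Fintype.card_fin]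
    field_simp
  refine ⟨hIntR, ?_⟩
  -- the representation
  unfold freeKer latticeKernel
  rw [hbox, Complex.real_smul]
  have hlp : ∀ t, wN N t * levelProd (d := d) n t x =
      (n : ℝ) ^ (d + 1) * (wN N t * ∏ ν, srwHeatKernel (2 * (n : ℝ) ^ 2 * t) (x ν)) := by
    intro t
    simp only [levelProd]
    rw [Finset.prod_mul_distrib, Finset.prod_const, Finset.card_univ, Fintype.card_fin]
    ring
  simp_rw [hlp]
  rw [integral_const_mul]
  push_cast
  field_simp
  rw [hν]

end Representation

end Summit.QuantumFields.BalabanUV.T4Continuum.G183FreePartRate
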